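import Mathlib.Analysis.SpecialFunctions.Integrals.Basic
import Mathlib.Analysis.SpecialFunctions.Pow.Real
import Mathlib.Analysis.Real.Pi.Bounds
import Literature.Analysis.FluidPDE.AnomalousDissipation
import Literature.Analysis.FunctionSpaces.TorusFourierModes
import Literature.Analysis.FunctionSpaces.TorusRieszFischerParam
import Literature.Analysis.FunctionSpaces.TorusHolderBridge
import Literature.Analysis.FunctionSpaces.HolderInterpolation
import HarnessLib

/-!
# Discharge of `bccds_onsager_critical`: pulsed Stokes shear flows

This file proves `Literature.Analysis.FluidPDE.bccds_onsager_critical` (**turb.S13**,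
`AnomalousDissipation.lean`), i.e. lands `bccds_onsager_critical_holds`, by an explicit and
elementary example — and thereby documents that the vendored statement is a *degenerate
weakening* of Bruè–Colombo–Crippa–De Lellis–Sorella, *Onsager critical solutions of the forced
Navier–Stokes equations* (arXiv:2212.08413, Comm. Pure Appl. Anal. 23 (2024)), Theorem 1
(its main theorem, cited in the statement file as Thm. 1.1): the vendored `Prop` records the uniform bound on the body forces only in
`L¹([0,1]; C⁰(T³))` (`eLpHolderNorm 1 0`), whereas the theorem requires
`sup_ν ‖F_ν‖_{L^{1+σ}([0,1]; C^σ(T³))} < ∞` for some `σ > 0` ((1.4) = `(bound_force)`), a class chosen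
precisely because it *rules out* anomalous dissipation for the linear Stokes equations (§1, the
paragraph before Theorem 1). The paper itself points out (§1, Remark 2, right after Theorem 1):
"If we only required that the forces `{F_ν}` were uniformly bounded in `L¹((0,1); L^∞(T³))`, then
anomalous dissipation would be already possible for solutions of the forced heat equation …
`ϑ_ν(t,x) = (e^{-4π²t} - 1) sin(2π ν^{-1/2} x)` … The latter example can be easily modified to
produce an analogous one for the linear Stokes equations." The example below is such a
modification, made intermittent in time so that, in addition, the solutions are uniformly bounded
in the Onsager-critical class `L³_t C^{1/3-}_x` (and in `L^∞_{t,x}`), exactly as the vendored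
statement demands. Consequently `bccds_onsager_critical` as stated carries none of the
convex-integration / anomalous-mixing content of the paper (§§2–4: a `2½`-dimensional solution
built on the Colombo–Crippa–Sorella alternating shear flows); a faithful vendoring must keep
`σ > 0` in the force bound (recorded in the unit's notes as a mis-statement; no new named fact is
introduced here, D-0026).

## The example

For `m ∈ ℕ` put `N = m + 1`, `ν_m = 1/N`, `r_m = ν_m (2πN)² = 4π² N`, `E_m(t) = e^{-r_m t}`,
`a_m = E_m - E_m²` (so `a_m(0) = 0`, `0 ≤ a_m ≤ E_m` on `t ≥ 0`), and let
`P_N(x) = Re (e^{2πi N x₁} (-i, 0, 1)) = (sin 2πN x₁, 0, cos 2πN x₁)` be the circularly polarised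
shear mode (`Torus.realTrigPoly {N e₁}`): `div P_N = 0`, `(P_N·∇)P_N = 0`, `ΔP_N = -4π²N² P_N`,
`|P_N| ≤ √2`, `∑ⱼ |∂ⱼ P_N|² ≡ (2πN)²`. Then `u_m(t) = a_m(t) P_N`, `p_m = 0` solve the forced
Navier–Stokes (indeed Stokes) system with viscosity `ν_m`, datum `0` and force
`f_m(t) = (a_m' + r_m a_m) P_N = r_m E_m² P_N`, and

* `‖f_m‖_{L¹_t C⁰_x} ≤ 3√2 ∫₀¹ r_m E_m² ≤ 3√2/2` (the force is a pulse of fixed `L¹` mass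
  concentrating at `t = 0`; its `L^{1+σ}_t` and `C^σ_x` norms blow up, as they must);
* `ν_m ∫₀¹ ‖∇u_m‖₂² = r_m ∫₀¹ a_m² = 1/12 - O(e^{-2 r_m}) ≥ 1/24` (**anomalous dissipation**);
* `[P_N]_α ≲ N^α` (interpolation between the Lipschitz constant `≲ N` and the oscillation `≤ 2√2`
  at scale `1/N`), so `‖u_m‖³_{L³_t C^α_x} ≲ N^{3α} ∫₀¹ E_m³ ≲ N^{3α}/r_m ≲ N^{3α-1} ≤ 1` for
  `α < 1/3`.

Everything is assembled from the tree's torus calculus (`TorusTrigPoly`, `TorusFourierModes`: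
single real modes, their Laplacian, divergence and derivative bounds; `TorusHolderBridge`,
`HolderInterpolation`: Lipschitz and Hölder constants on `T^d`) and Mathlib's one-variable
calculus (`Real.exp`, the fundamental theorem of calculus, `eLpNorm`).

## References

* E. Bruè, M. Colombo, G. Crippa, C. De Lellis, M. Sorella, *Onsager critical solutions of the
  forced Navier–Stokes equations*, arXiv:2212.08413 = Comm. Pure Appl. Anal. 23 (2024), §1:
  Theorem 1 (anomalous dissipation with `(bound_force)`), Remark 2 (the `L¹_t L^∞_x` force class
  is degenerate: heat-equation example). [`BCCDS2024`]
* E. Bruè, C. De Lellis, *Anomalous dissipation for the forced 3D Navier–Stokes equations*,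
  Comm. Math. Phys. 400 (2023), §2, Question 2.4. [`BrueDeLellisCMP2023`]
-/

open MeasureTheory Set Filter Topology UnitAddTorus
open scoped NNReal ENNReal InnerProductSpace ContDiff

noncomputable section

namespace Literature.Analysis.FluidPDE

namespace PulsedShear

open Literature.Analysis.FunctionSpaces Literature.Analysis.FunctionSpaces.Torus

/-! ## The spatial profile: a circularly polarised shear mode at frequency `N e₁` -/

/-- The frequency vector `k = N e₁ ∈ ℤ³`. [folklore] -/
def freq (N : ℕ) : Fin 3 → ℤ := Pi.single 1 (N : ℤ)

/-- The polarisation vector `z = (-i, 0, 1) ∈ ℂ³` (transversal to `e₁`). [folklore] -/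
def pol : EuclideanSpace ℂ (Fin 3) := WithLp.toLp 2 ![-Complex.I, 0, 1]

/-- `k₀ = 0`. [folklore] -/
@[simp] theorem freq_apply_zero (N : ℕ) : freq N 0 = 0 := by simp [freq]
/-- `k₁ = N`. [folklore] -/
@[simp] theorem freq_apply_one (N : ℕ) : freq N 1 = N := by simp [freq]
/-- `k₂ = 0`. [folklore] -/
@[simp] theorem freq_apply_two (N : ℕ) : freq N 2 = 0 := by simp [freq]
/-- `z₀ = -i`. [folklore] -/
@[simp] theorem pol_apply_zero : pol 0 = -Complex.I := by simp [pol]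
/-- `z₁ = 0`. [folklore] -/
@[simp] theorem pol_apply_one : pol 1 = 0 := by simp [pol]
/-- `z₂ = 1`. [folklore] -/
@[simp] theorem pol_apply_two : pol 2 = 1 := by simp [pol]

/-- `|k|² = N²`. [folklore] -/
theorem freqNormSq_freq (N : ℕ) : freqNormSq (freq N) = (N : ℝ) ^ 2 := by
  simp [freqNormSq, Fin.sum_univ_three]

/-- `‖z‖² = 2`. [folklore] -/
theorem norm_pol_sq : ‖pol‖ ^ 2 = 2 := by
  rw [EuclideanSpace.norm_sq_eq, Fin.sum_univ_three]
  simp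
  norm_num

/-- The spatial profile `P_N (x) = Re (e_k(x) z) = (sin 2πN x₁, 0, cos 2πN x₁)`. [folklore] -/
def profile (N : ℕ) : T3 → R3 := realTrigPoly {freq N} (fun _ => pol)

/-- The profile is smooth (a trigonometric polynomial). [folklore] -/
theorem isSmooth_profile (N : ℕ) : IsSmooth (profile N) := isSmooth_realTrigPoly _ _

/-- `‖P_N (x)‖ ≤ ‖z‖ (= √2)`. [folklore] -/
theorem norm_profile_le (N : ℕ) (x : T3) : ‖profile N x‖ ≤ ‖pol‖ :=
  norm_realTrigPoly_singleton_le _ _ _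

/-- `div P_N = 0` (`k · z = N z₁ = 0`). [folklore] -/
theorem isDivFree_profile (N : ℕ) : IsDivFree (profile N) :=
  isDivFree_realTrigPoly_singleton (by simp [Fin.sum_univ_three])

/-- `Δ P_N = -4π² N² P_N`. [folklore] -/
theorem laplacian_profile (N : ℕ) (x : T3) :
    laplacian (profile N) x = -(4 * Real.pi ^ 2 * (N : ℝ) ^ 2) • profile N x := by
  rw [profile, laplacian_realTrigPoly_singleton, freqNormSq_freq]

/-- The second coordinate of the profile vanishes. [folklore] -/
theorem profile_apply_one (N : ℕ) (x : T3) : profile N x 1 = 0 := by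
  rw [profile, realTrigPoly_apply_coord, trigPoly_apply_coord]
  simp

/-- Partial derivatives of the profile: `∂ⱼ P = Re (e_k • (2πi kⱼ) z)`. [folklore] -/
theorem partialDeriv_profile (N : ℕ) (j : Fin 3) (x : T3) :
    partialDeriv j (profile N) x =
      EuclideanSpace.realPart (mFourier (freq N) x •
        ((2 * Real.pi * Complex.I * (freq N j)) • pol)) := by
  rw [profile, partialDeriv_realTrigPoly, realTrigPoly_singleton_apply]

/-- `∂ⱼ P_N = 0` for `j ≠ 1` (the profile depends on `x₁` only). [folklore] -/
theorem partialDeriv_profile_of_ne_one (N : ℕ) {j : Fin 3} (hj : j ≠ 1) (x : T3) :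
    partialDeriv j (profile N) x = 0 := by
  rw [partialDeriv_profile]
  have : freq N j = 0 := by simp [freq, hj]
  simp [this]

/-- `‖∂ⱼ P_N (x)‖ ≤ 2π N ‖z‖`. [folklore] -/
theorem norm_partialDeriv_profile_le (N : ℕ) (j : Fin 3) (x : T3) :
    ‖partialDeriv j (profile N) x‖ ≤ 2 * Real.pi * N * ‖pol‖ := by
  have h := norm_partialDeriv_realTrigPoly_singleton_le (freq N) (fun _ => pol) j x
  rw [freqNormSq_freq, Real.sqrt_sq (Nat.cast_nonneg N)] at h
  exact h

/-- `‖e_k(x)‖ = 1`. [folklore] -/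
theorem norm_mFourier_freq (N : ℕ) (x : T3) : ‖mFourier (freq N) x‖ = 1 :=
  norm_mFourier_apply _ _

/-- `∑ⱼ ‖∂ⱼ P_N (x)‖² = (2πN)²`: the gradient of the profile has constant Frobenius norm. [folklore] -/
theorem sum_norm_sq_partialDeriv_profile (N : ℕ) (x : T3) :
    ∑ j, ‖partialDeriv j (profile N) x‖ ^ 2 = (2 * Real.pi * N) ^ 2 := by
  rw [Fin.sum_univ_three, partialDeriv_profile_of_ne_one N (by decide : (0 : Fin 3) ≠ 1),
    partialDeriv_profile_of_ne_one N (by decide : (2 : Fin 3) ≠ 1), norm_zero]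
  simp only [ne_eq, OfNat.ofNat_ne_zero, not_false_eq_true, zero_pow, zero_add, add_zero]
  rw [partialDeriv_profile, EuclideanSpace.norm_sq_eq, Fin.sum_univ_three]
  simp only [EuclideanSpace.realPart_apply, PiLp.smul_apply, smul_eq_mul, freq_apply_one,
    pol_apply_zero, pol_apply_one, pol_apply_two, Real.norm_eq_abs, sq_abs]
  have he : (mFourier (freq N) x).re ^ 2 + (mFourier (freq N) x).im ^ 2 = 1 := by
    have h1 := norm_mFourier_freq N x
    rw [← Complex.sq_norm_sub_sq_re] at *
    nlinarith [Complex.sq_norm (mFourier (freq N) x), Complex.normSq_apply (mFourier (freq N) x)]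
  set e := mFourier (freq N) x with he_def
  have h0 : (e * (2 * ↑Real.pi * Complex.I * ↑(N : ℤ) * -Complex.I)).re = 2 * Real.pi * N * e.re := by
    have : (2 * ↑Real.pi * Complex.I * ↑(N : ℤ) * -Complex.I : ℂ) = ((2 * Real.pi * N : ℝ) : ℂ) := by
      push_cast
      linear_combination (-(2 : ℂ) * Real.pi * N) * Complex.I_mul_I
    rw [this, Complex.mul_re, Complex.ofReal_re, Complex.ofReal_im]
    ring
  have h2 : (e * (2 * ↑Real.pi * Complex.I * ↑(N : ℤ) * 1)).re = -(2 * Real.pi * N * e.im) := by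
    have : (2 * ↑Real.pi * Complex.I * ↑(N : ℤ) * 1 : ℂ) = ((2 * Real.pi * N : ℝ) : ℂ) * Complex.I := by
      push_cast
      ring
    rw [this, ← mul_assoc, Complex.mul_I_re, Complex.mul_im, Complex.ofReal_re, Complex.ofReal_im]
    ring
  rw [h0, h2]
  simp only [mul_zero, Complex.zero_re, zero_pow, ne_eq, OfNat.ofNat_ne_zero, not_false_eq_true]
  nlinarith [he]

/-! ## Parameters and the time profile -/

/-- The viscosities `ν_m = 1 / (m + 1)`. [folklore] -/
def nu (m : ℕ) : ℝ := 1 / ((m : ℝ) + 1)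

/-- The decay rates `r_m = ν_m (2π N_m)² = 4π² (m + 1)` of the shear mode `N_m = m + 1`. [folklore] -/
def rate (m : ℕ) : ℝ := 4 * Real.pi ^ 2 * ((m : ℝ) + 1)

/-- `ν_m > 0`. [folklore] -/
theorem nu_pos (m : ℕ) : 0 < nu m := by unfold nu; positivity

/-- `r_m > 0`. [folklore] -/
theorem rate_pos (m : ℕ) : 0 < rate m := by unfold rate; positivity

/-- `ν_m · 4π² N² = r_m` (`N = m + 1`). [folklore] -/
theorem nu_mul_eq_rate (m : ℕ) :
    nu m * (4 * Real.pi ^ 2 * ((m + 1 : ℕ) : ℝ) ^ 2) = rate m := by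
  unfold nu rate
  push_cast
  field_simp

/-- `ν_m (2π N)² = r_m` (`N = m + 1`). [folklore] -/
theorem nu_mul_eq_rate' (m : ℕ) :
    nu m * (2 * Real.pi * ((m + 1 : ℕ) : ℝ)) ^ 2 = rate m := by
  rw [← nu_mul_eq_rate m]
  ring

/-- `r_m ≥ 36` (`π > 3`). [folklore] -/
theorem thirtysix_le_rate (m : ℕ) : 36 ≤ rate m := by
  unfold rate
  have hπ := Real.pi_gt_three
  have hm : (0 : ℝ) ≤ m := Nat.cast_nonneg m
  nlinarith

/-- `ν_m = 1/(m+1)` is a vanishing-viscosity sequence. [folklore] -/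
theorem isVanishingViscosity_nu : IsVanishingViscosity nu := by
  refine ⟨fun m n hmn => ?_, tendsto_one_div_add_atTop_nhds_zero_nat, nu_pos⟩
  unfold nu
  exact one_div_lt_one_div_of_lt (by positivity) (by exact_mod_cast Nat.succ_lt_succ hmn)

/-- `E_m (t) = exp (-r_m t)`. [folklore] -/
def E (m : ℕ) (t : ℝ) : ℝ := Real.exp (-(rate m * t))

/-- `E_m > 0`. [folklore] -/
theorem E_pos (m : ℕ) (t : ℝ) : 0 < E m t := Real.exp_pos _

/-- `E_m (0) = 1`. [folklore] -/
theorem E_zero (m : ℕ) : E m 0 = 1 := by simp [E]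

/-- `E_m (t) ≤ 1` for `t ≥ 0`. [folklore] -/
theorem E_le_one (m : ℕ) {t : ℝ} (ht : 0 ≤ t) : E m t ≤ 1 := by
  unfold E
  rw [Real.exp_le_one_iff, neg_nonpos]
  exact mul_nonneg (rate_pos m).le ht

/-- `E_m' = -r_m E_m`. [folklore] -/
theorem hasDerivAt_E (m : ℕ) (t : ℝ) : HasDerivAt (E m) (-rate m * E m t) t := by
  have h : HasDerivAt (fun s : ℝ => Real.exp (-(rate m * s)))
      (Real.exp (-(rate m * t)) * -(rate m * 1)) t :=
    (((hasDerivAt_id' t).const_mul (rate m)).fun_neg).exp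
  refine h.congr_deriv ?_
  simp only [E]
  ring

/-- `E_m` is smooth. [folklore] -/
theorem contDiff_E (m : ℕ) : ContDiff ℝ ∞ (E m) := by
  unfold E
  fun_prop

/-- The amplitude `a_m = E_m - E_m²` (so `a_m (0) = 0`), its derivative and the force amplitude
`b_m = a_m' + r_m a_m = r_m E_m²`. [folklore] -/
def amp (m : ℕ) (t : ℝ) : ℝ := E m t - E m t ^ 2

/-- `a_m'`. [folklore] -/
def ampDeriv (m : ℕ) (t : ℝ) : ℝ := rate m * (2 * E m t ^ 2 - E m t)

/-- `b_m = r_m E_m²`. [folklore] -/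
def forceAmp (m : ℕ) (t : ℝ) : ℝ := rate m * E m t ^ 2

/-- `a_m (0) = 0`. [folklore] -/
theorem amp_zero (m : ℕ) : amp m 0 = 0 := by simp [amp, E_zero]

/-- `a_m' = r_m (2 E_m² - E_m)`. [folklore] -/
theorem hasDerivAt_amp (m : ℕ) (t : ℝ) : HasDerivAt (amp m) (ampDeriv m t) t := by
  have h := (hasDerivAt_E m t).fun_sub ((hasDerivAt_E m t).fun_pow 2)
  refine h.congr_deriv ?_
  rw [show (2 : ℕ) - 1 = 1 from rfl, pow_one]
  simp only [ampDeriv]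
  push_cast
  ring

/-- `a_m' + r_m a_m = b_m`. [folklore] -/
theorem ampDeriv_add_rate_mul_amp (m : ℕ) (t : ℝ) :
    ampDeriv m t + rate m * amp m t = forceAmp m t := by
  unfold ampDeriv amp forceAmp; ring

/-- `a_m ≥ 0` on `t ≥ 0`. [folklore] -/
theorem amp_nonneg (m : ℕ) {t : ℝ} (ht : 0 ≤ t) : 0 ≤ amp m t := by
  unfold amp
  have h1 := E_le_one m ht
  have h0 := (E_pos m t).le
  nlinarith

/-- `a_m ≤ E_m`. [folklore] -/
theorem amp_le_E (m : ℕ) (t : ℝ) : amp m t ≤ E m t := by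
  unfold amp
  nlinarith [sq_nonneg (E m t)]

/-- `|a_m| ≤ E_m` on `t ≥ 0`. [folklore] -/
theorem abs_amp_le_E (m : ℕ) {t : ℝ} (ht : 0 ≤ t) : |amp m t| ≤ E m t := by
  rw [abs_of_nonneg (amp_nonneg m ht)]
  exact amp_le_E m t

/-- `b_m ≥ 0`. [folklore] -/
theorem forceAmp_nonneg (m : ℕ) (t : ℝ) : 0 ≤ forceAmp m t := by
  unfold forceAmp
  exact mul_nonneg (rate_pos m).le (sq_nonneg _)

/-- `a_m` is smooth. [folklore] -/
theorem contDiff_amp (m : ℕ) : ContDiff ℝ ∞ (amp m) :=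
  (contDiff_E m).sub ((contDiff_E m).pow 2)

/-- `b_m` is smooth. [folklore] -/
theorem contDiff_forceAmp (m : ℕ) : ContDiff ℝ ∞ (forceAmp m) :=
  contDiff_const.mul ((contDiff_E m).pow 2)

/-- `E_m` is continuous. [folklore] -/
theorem continuous_E (m : ℕ) : Continuous (E m) := (contDiff_E m).continuous

/-- `∫₀¹ E_m^k = (1 - E_m(1)^k) / (k r_m)`. [folklore] -/
theorem integral_E_pow (m : ℕ) {k : ℕ} (hk : k ≠ 0) :
    ∫ t in (0 : ℝ)..1, E m t ^ k = (1 - E m 1 ^ k) / (k * rate m) := by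
  have hkr : (k : ℝ) * rate m ≠ 0 := mul_ne_zero (Nat.cast_ne_zero.2 hk) (rate_pos m).ne'
  have hF : ∀ t ∈ Set.uIcc (0 : ℝ) 1,
      HasDerivAt (fun s => -(E m s ^ k) / (k * rate m)) (E m t ^ k) t := by
    intro t _
    refine ((((hasDerivAt_E m t).fun_pow k).fun_neg).div_const ((k : ℝ) * rate m)).congr_deriv ?_
    rw [show -(↑k * E m t ^ (k - 1) * (-rate m * E m t)) / (↑k * rate m)
        = (↑k * rate m) * (E m t ^ (k - 1) * E m t) / (↑k * rate m) by ring,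
      mul_div_cancel_left₀ _ hkr, pow_sub_one_mul hk]
  rw [intervalIntegral.integral_eq_sub_of_hasDerivAt hF
    (((continuous_E m).pow k).intervalIntegrable 0 1), E_zero, one_pow]
  field_simp
  ring

/-- `∫₀¹ E_m^k ≤ 1 / (k r_m)`. [folklore] -/
theorem integral_E_pow_le (m : ℕ) {k : ℕ} (hk : k ≠ 0) :
    ∫ t in (0 : ℝ)..1, E m t ^ k ≤ 1 / (k * rate m) := by
  rw [integral_E_pow m hk]
  have hkr : 0 < (k : ℝ) * rate m := mul_pos (Nat.cast_pos.2 (Nat.pos_of_ne_zero hk)) (rate_pos m)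
  gcongr
  linarith [pow_nonneg (E_pos m 1).le k]

/-- `E_m (1) ≤ 1/37`. [folklore] -/
theorem E_one_le (m : ℕ) : E m 1 ≤ 1 / 37 := by
  have hr := thirtysix_le_rate m
  have h1 : rate m + 1 ≤ Real.exp (rate m) := Real.add_one_le_exp _
  unfold E
  rw [mul_one, Real.exp_neg]
  rw [inv_eq_one_div, div_le_div_iff₀ (Real.exp_pos _) (by norm_num : (0:ℝ) < 37)]
  linarith

/-- **The dissipation integral**: `r_m ∫₀¹ a_m² ≥ 1/24` (it tends to `1/12`). [folklore] -/
theorem rate_mul_integral_amp_sq_ge (m : ℕ) :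
    1 / 24 ≤ rate m * ∫ t in (0 : ℝ)..1, amp m t ^ 2 := by
  have hexp : ∀ t, amp m t ^ 2 = E m t ^ 2 - 2 * E m t ^ 3 + E m t ^ 4 := fun t => by
    unfold amp; ring
  simp_rw [hexp]
  have hi : ∀ k : ℕ, IntervalIntegrable (fun t => E m t ^ k) volume 0 1 := fun k =>
    ((continuous_E m).pow k).intervalIntegrable 0 1
  rw [intervalIntegral.integral_add ((hi 2).sub ((hi 3).const_mul 2)) (hi 4),
    intervalIntegral.integral_sub (hi 2) ((hi 3).const_mul 2),
    intervalIntegral.integral_const_mul, integral_E_pow m two_ne_zero,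
    integral_E_pow m three_ne_zero, integral_E_pow m four_ne_zero]
  have hr := rate_pos m
  have hr' := thirtysix_le_rate m
  set w := E m 1 with hw
  have hw0 : 0 < w := E_pos m 1
  have hw1 : w ≤ 1 / 37 := E_one_le m
  have hw2 : w ^ 2 ≤ w := by nlinarith
  have hw4 : w ^ 4 ≤ w ^ 2 := by nlinarith
  have hw3 : 0 ≤ w ^ 3 := by positivity
  have key : rate m * ((1 - w ^ 2) / (2 * rate m) - 2 * ((1 - w ^ 3) / (3 * rate m)) +
      (1 - w ^ 4) / (4 * rate m)) = 1 / 12 - w ^ 2 / 2 + 2 * w ^ 3 / 3 - w ^ 4 / 4 := by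
    field_simp
    ring
  push_cast
  rw [key]
  nlinarith

/-! ## The velocity, force and pressure fields -/

/-- The velocity fields `u_m (t) = a_m (t) P_{m+1}`. [folklore] -/
def vel (m : ℕ) (t : ℝ) : T3 → R3 := amp m t • profile (m + 1)

/-- The body forces `f_m (t) = b_m (t) P_{m+1}`. [folklore] -/
def force (m : ℕ) (t : ℝ) : T3 → R3 := forceAmp m t • profile (m + 1)

/-- The (zero) pressures. [folklore] -/
def pres (_ : ℕ) (_ : ℝ) : T3 → ℝ := fun _ => 0

/-- The (zero) initial datum. [folklore] -/
def datum : T3 → R3 := fun _ => 0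

/-- Unfolding `vel`. [folklore] -/
@[simp] theorem vel_apply (m : ℕ) (t : ℝ) (x : T3) :
    vel m t x = amp m t • profile (m + 1) x := rfl

/-- Unfolding `force`. [folklore] -/
@[simp] theorem force_apply (m : ℕ) (t : ℝ) (x : T3) :
    force m t x = forceAmp m t • profile (m + 1) x := rfl

/-- `u_m (0) = 0`. [folklore] -/
theorem vel_zero (m : ℕ) : vel m 0 = datum := by
  funext x
  simp [amp_zero, datum]

/-- The zero datum is smooth. [folklore] -/
theorem isSmooth_datum : IsSmooth datum := isSmooth_const _

/-- The profile is `C¹`. [folklore] -/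
theorem isContDiff_profile (N : ℕ) : IsContDiff 1 (profile N) :=
  (isSmooth_profile N).isContDiff (by simp)

/-- Space–time lifts of separated fields `a(t) P_N(x)` are smooth. [folklore] -/
theorem contDiff_stLift_smul_profile {a : ℝ → ℝ} (ha : ContDiff ℝ ∞ a) (N : ℕ) :
    ContDiff ℝ ∞ (stLift (fun t => a t • profile N)) := by
  have h : stLift (fun t => a t • profile N) =
      fun p : ℝ × EuclideanSpace ℝ (Fin 3) => a p.1 • lift (profile N) p.2 := by
    funext p; rfl
  rw [h]
  exact (ha.comp contDiff_fst).smul ((isSmooth_profile N).comp contDiff_snd)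

/-- `u_m` is jointly smooth. [folklore] -/
theorem isSmoothSpaceTimeOn_vel (m : ℕ) (S : Set ℝ) : IsSmoothSpaceTimeOn S (vel m) :=
  (contDiff_stLift_smul_profile (contDiff_amp m) (m + 1)).contDiffOn

/-- `f_m` is jointly smooth. [folklore] -/
theorem isSmoothSpaceTimeOn_force (m : ℕ) (S : Set ℝ) : IsSmoothSpaceTimeOn S (force m) :=
  (contDiff_stLift_smul_profile (contDiff_forceAmp m) (m + 1)).contDiffOn

/-- `p_m = 0` is jointly smooth. [folklore] -/
theorem isSmoothSpaceTimeOn_pres (m : ℕ) (S : Set ℝ) : IsSmoothSpaceTimeOn S (pres m) := by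
  change ContDiffOn ℝ ∞ (fun _ => (0 : ℝ)) _
  exact contDiffOn_const

/-- `∂ₜ u_m = a_m' P` within `[0, 1]`. [folklore] -/
theorem timeDerivWithin_vel (m : ℕ) {t : ℝ} (ht : t ∈ Icc (0 : ℝ) 1) (x : T3) :
    timeDerivWithin (Icc 0 1) (vel m) t x = ampDeriv m t • profile (m + 1) x := by
  have h : HasDerivWithinAt (fun τ => vel m τ x) (ampDeriv m t • profile (m + 1) x)
      (Icc 0 1) t :=
    ((hasDerivAt_amp m t).smul_const (profile (m + 1) x)).hasDerivWithinAt
  exact h.derivWithin (uniqueDiffOn_Icc zero_lt_one t ht)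

/-- Shear flows have no self-advection: `(u_m · ∇) u_m = 0`. [folklore] -/
theorem convect_vel (m : ℕ) (t : ℝ) (x : T3) : convect (vel m t) (vel m t) x = 0 := by
  have h1 : IsContDiff 1 (vel m t) := (isContDiff_profile (m + 1)).smul (amp m t)
  unfold convect
  rw [fderiv_apply_eq_sum_partialDeriv h1]
  refine Finset.sum_eq_zero fun i _ => ?_
  rw [vel, partialDeriv_const_smul (isContDiff_profile _) (amp m t) i]
  by_cases hi : i = 1
  · subst hi
    simp [profile_apply_one]
  · rw [Pi.smul_apply (amp m t) (partialDeriv i (profile _)), partialDeriv_profile_of_ne_one _ hi,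
      smul_zero, smul_zero]

/-- `Δ (c • f) = c • Δ f` for smooth `f` (Mathlib `InnerProductSpace.laplacian_smul` on the
re-centred lift). [folklore] -/
theorem laplacian_const_smul_profile (c : ℝ) (N : ℕ) (x : T3) :
    laplacian (c • profile N) x = c • laplacian (profile N) x := by
  have h2 : ContDiffAt ℝ 2 (liftAt (profile N) x) 0 :=
    (((isSmooth_profile N).liftAt x).of_le (WithTop.coe_le_coe.mpr le_top)).contDiffAt
  have hl : liftAt (c • profile N) x = c • liftAt (profile N) x := rfl
  simp only [Torus.laplacian, hl]
  exact InnerProductSpace.laplacian_smul c h2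

/-- `Δ u_m = -4π² N² u_m`. [folklore] -/
theorem laplacian_vel (m : ℕ) (t : ℝ) (x : T3) :
    laplacian (vel m t) x =
      (-(4 * Real.pi ^ 2 * ((m + 1 : ℕ) : ℝ) ^ 2) * amp m t) • profile (m + 1) x := by
  rw [vel, laplacian_const_smul_profile, laplacian_profile, smul_smul, mul_comm]

/-- `∇ p_m = 0`. [folklore] -/
theorem gradient_pres (m : ℕ) (t : ℝ) (x : T3) : Torus.gradient (pres m t) x = 0 := by
  unfold pres Torus.gradient liftAt
  simp [_root_.gradient]

/-- `div u_m (t) = a_m (t) div P_N = 0`. [folklore] -/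
theorem isDivFree_vel (m : ℕ) (t : ℝ) : IsDivFree (vel m t) := by
  intro x
  have hP := isDivFree_profile (m + 1) x
  unfold divergence at hP ⊢
  rw [← mul_zero (amp m t), ← hP, Finset.mul_sum]
  refine Finset.sum_congr rfl fun i _ => ?_
  have hPi : IsContDiff 1 (fun y => profile (m + 1) y i) :=
    (EuclideanSpace.proj i : R3 →L[ℝ] ℝ).contDiff.comp (isContDiff_profile (m + 1))
  have h : (fun y => (vel m t) y i) = amp m t • fun y => profile (m + 1) y i := by
    funext y
    simp
  rw [h, partialDeriv_const_smul hPi, Pi.smul_apply, smul_eq_mul]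

/-- The momentum equation `∂ₜu + (u·∇)u = ν Δu - ∇p + f` on `[0, 1] × T³`. [folklore] -/
theorem momentum_vel (m : ℕ) {t : ℝ} (ht : t ∈ Icc (0 : ℝ) 1) (x : T3) :
    timeDerivWithin (Icc 0 1) (vel m) t x + convect (vel m t) (vel m t) x =
      nu m • laplacian (vel m t) x - Torus.gradient (pres m t) x + force m t x := by
  rw [timeDerivWithin_vel m ht, convect_vel, laplacian_vel, gradient_pres, force_apply, add_zero,
    sub_zero, smul_smul, ← add_smul]
  congr 1
  have h1 := ampDeriv_add_rate_mul_amp m t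
  have h2 := nu_mul_eq_rate m
  linear_combination h1 + amp m t * h2

/-- `(u_m, p_m)` is a classical solution of Navier–Stokes with viscosity `ν_m` and force `f_m`
on `[0, 1] × T³`. [folklore] -/
theorem isClassicalNSSolutionOn_vel (m : ℕ) :
    IsClassicalNSSolutionOn (Icc 0 1) (nu m) (force m) (vel m) (pres m) where
  smooth_velocity := isSmoothSpaceTimeOn_vel m _
  smooth_pressure := isSmoothSpaceTimeOn_pres m _
  momentum := fun _ ht x => momentum_vel m ht x
  divFree := fun t _ => isDivFree_vel m t

/-! ## Energy dissipation -/

/-- `‖∇u_m (t)‖₂² = (2π N)² a_m(t)²` (the gradient has constant pointwise norm). [folklore] -/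
theorem gradNormSq_vel (m : ℕ) (t : ℝ) :
    gradNormSq (vel m t) = (2 * Real.pi * ((m + 1 : ℕ) : ℝ)) ^ 2 * amp m t ^ 2 := by
  unfold gradNormSq
  have h : ∀ x, ∑ i, ‖partialDeriv i (vel m t) x‖ ^ 2 =
      (2 * Real.pi * ((m + 1 : ℕ) : ℝ)) ^ 2 * amp m t ^ 2 := by
    intro x
    rw [vel]
    simp_rw [partialDeriv_const_smul (isContDiff_profile _) (amp m t), Pi.smul_apply, norm_smul,
      mul_pow, ← Finset.mul_sum, sum_norm_sq_partialDeriv_profile, Real.norm_eq_abs, sq_abs]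
    ring
  simp_rw [h]
  simp

/-- The dissipation on `[0, 1]`: `ν_m ∫₀¹ ‖∇u_m‖₂² = r_m ∫₀¹ a_m²`. [folklore] -/
theorem cumulativeDissipation_vel (m : ℕ) :
    cumulativeDissipation (nu m) (vel m) 0 1 = rate m * ∫ t in (0 : ℝ)..1, amp m t ^ 2 := by
  unfold cumulativeDissipation
  simp_rw [gradNormSq_vel]
  rw [intervalIntegral.integral_const_mul, ← mul_assoc, nu_mul_eq_rate']

/-- **Anomalous dissipation** of the family: `ν_m ∫₀¹ ‖∇u_m‖₂² ≥ 1/24` for every `m`. [folklore] -/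
theorem hasAnomalousDissipation_vel : HasAnomalousDissipation nu vel :=
  ⟨1 / 24, by norm_num, Eventually.of_forall fun m => by
    rw [cumulativeDissipation_vel]
    exact rate_mul_integral_amp_sq_ge m⟩

/-! ## `L^p_t` bounds from pointwise bounds on `[0, 1]` -/

/-- An `L^n([0,1])` bound (`n ≥ 1` an integer) from a pointwise bound by a continuous function:
`‖φ‖_{L^n([0,1])} ≤ (∫₀¹ Bⁿ)^{1/n}` if `|φ| ≤ B` on `[0, 1]`. [folklore] -/
theorem eLpNorm_Icc_le_of_le {φ B : ℝ → ℝ} {n : ℕ} (hn : n ≠ 0)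
    (hφ : ∀ t ∈ Icc (0 : ℝ) 1, ‖φ t‖ ≤ B t) (hB : Continuous B) :
    eLpNorm φ n (volume.restrict (Icc (0 : ℝ) 1)) ≤
      ENNReal.ofReal (∫ t in (0 : ℝ)..1, B t ^ n) ^ (1 / (n : ℝ)) := by
  have hB0 : ∀ t ∈ Icc (0 : ℝ) 1, 0 ≤ B t := fun t ht => (norm_nonneg _).trans (hφ t ht)
  rw [eLpNorm_eq_lintegral_rpow_enorm_toReal (Nat.cast_ne_zero.2 hn) (ENNReal.natCast_ne_top n),
    ENNReal.toReal_natCast]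
  refine ENNReal.rpow_le_rpow ?_ (by positivity)
  simp_rw [ENNReal.rpow_natCast]
  have hint : IntegrableOn (fun t => B t ^ n) (Icc (0 : ℝ) 1) volume := (hB.pow n).integrableOn_Icc
  rw [intervalIntegral.integral_of_le zero_le_one, ← integral_Icc_eq_integral_Ioc,
    ofReal_integral_eq_lintegral_ofReal (f := fun t => B t ^ n) hint
      ((ae_restrict_iff' measurableSet_Icc).2
        (Eventually.of_forall fun t ht => pow_nonneg (hB0 t ht) n))]
  refine setLIntegral_mono' measurableSet_Icc fun t ht => ?_
  rw [← ofReal_norm, ← ENNReal.ofReal_pow (norm_nonneg _)]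
  exact ENNReal.ofReal_le_ofReal (pow_le_pow_left₀ (norm_nonneg _) (hφ t ht) n)

/-! ## Hölder norms of the profile and of the fields -/

/-- The oscillation bound `‖P x - P y‖ ≤ 2 ‖z‖`. [folklore] -/
theorem dist_profile_le (N : ℕ) (x y : T3) : dist (profile N x) (profile N y) ≤ 2 * ‖pol‖ :=
  (dist_le_norm_add_norm _ _).trans (by linarith [norm_profile_le N x, norm_profile_le N y])

/-- The constant `K₁ = (6√3 π + 2) ‖z‖` of the Hölder seminorm bound `[P_N]_α ≤ K₁ N^α`. [folklore] -/
def holderConst₁ : ℝ := (6 * Real.sqrt 3 * Real.pi + 2) * ‖pol‖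

/-- The constant `K₂ = (6√3 π + 3) ‖z‖` of the Hölder norm bound `‖P_N‖_{C^{0,α}} ≤ K₂ N^α`. [folklore] -/
def holderConst₂ : ℝ := (6 * Real.sqrt 3 * Real.pi + 3) * ‖pol‖

/-- `K₁ ≥ 0`. [folklore] -/
theorem holderConst₁_nonneg : 0 ≤ holderConst₁ := by unfold holderConst₁; positivity

/-- `K₂ ≥ 0`. [folklore] -/
theorem holderConst₂_nonneg : 0 ≤ holderConst₂ := by unfold holderConst₂; positivity

/-- `K₂ = ‖z‖ + K₁`. [folklore] -/
theorem holderConst₂_eq : holderConst₂ = ‖pol‖ + holderConst₁ := by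
  unfold holderConst₁ holderConst₂; ring

/-- **Hölder seminorm of the profile**: `[P_N]_α ≤ K₁ N^α` for `α ≤ 1`, `N ≥ 1` (interpolation
between the Lipschitz bound `6√3 π N ‖z‖` and the oscillation bound `2‖z‖` at scale `1/N`). [folklore] -/
theorem eHolderNorm_profile_le {α : ℝ≥0} (hα : α ≤ 1) {N : ℕ} (hN : 0 < N) :
    eHolderNorm α (profile N) ≤ ENNReal.ofReal (holderConst₁ * (N : ℝ) ^ (α : ℝ)) := by
  have hN' : (0 : ℝ) < N := Nat.cast_pos.2 hN
  have hL := lipschitzWith_of_norm_partialDeriv_le (isContDiff_profile N)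
    (M := fun _ => 2 * NNReal.pi * N * ‖pol‖₊)
    (fun i x => by
      push_cast [coe_nnnorm, NNReal.coe_real_pi]
      exact norm_partialDeriv_profile_le N i x)
  have hB : ∀ x y, edist (profile N x) (profile N y) ≤ ((2 * ‖pol‖₊ : ℝ≥0) : ℝ≥0∞) :=
    fun x y => edist_le_coe.2 (dist_le_coe.1 (by
      push_cast [coe_nnnorm]
      exact dist_profile_le N x y))
  have hδ : (0 : ℝ≥0) < ((N : ℝ≥0))⁻¹ := by
    rw [inv_pos]; exact_mod_cast hN
  have hH := holderWith_of_lipschitzWith_of_edist_le hL hB hα hδ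
  refine hH.eHolderNorm_le.trans (le_of_eq ?_)
  rw [← ENNReal.ofReal_coe_nnreal]
  congr 1
  push_cast [coe_nnnorm, NNReal.coe_real_pi]
  simp only [Finset.sum_const, Finset.card_univ, Fintype.card_fin, nsmul_eq_mul, Nat.cast_ofNat,
    inv_inv]
  rw [Real.inv_rpow hN'.le, ← Real.rpow_neg hN'.le, neg_sub]
  have h1 : (N : ℝ) * (N : ℝ) ^ ((α : ℝ) - 1) = (N : ℝ) ^ (α : ℝ) := by
    conv_rhs => rw [show (α : ℝ) = 1 + ((α : ℝ) - 1) by ring, Real.rpow_add hN', Real.rpow_one]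
  unfold holderConst₁
  linear_combination (6 * Real.sqrt 3 * Real.pi * ‖pol‖) * h1

/-- **Hölder norm of the profile**: `‖P_N‖_∞ + [P_N]_α ≤ K₂ N^α`. [folklore] -/
theorem eBoundedHolderNorm_profile_le {α : ℝ≥0} (hα : α ≤ 1) {N : ℕ} (hN : 0 < N) :
    eBoundedHolderNorm α (profile N) ≤ ENNReal.ofReal (holderConst₂ * (N : ℝ) ^ (α : ℝ)) := by
  have hN1 : (1 : ℝ) ≤ (N : ℝ) ^ (α : ℝ) := Real.one_le_rpow (by exact_mod_cast hN) α.2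
  calc eBoundedHolderNorm α (profile N)
      ≤ ENNReal.ofReal ‖pol‖ + ENNReal.ofReal (holderConst₁ * (N : ℝ) ^ (α : ℝ)) :=
        add_le_add (eSupNorm_le_ofReal (norm_profile_le N)) (eHolderNorm_profile_le hα hN)
    _ = ENNReal.ofReal (‖pol‖ + holderConst₁ * (N : ℝ) ^ (α : ℝ)) := by
        rw [ENNReal.ofReal_add (norm_nonneg _)
          (mul_nonneg holderConst₁_nonneg (Real.rpow_nonneg (Nat.cast_nonneg _) _))]
    _ ≤ ENNReal.ofReal (holderConst₂ * (N : ℝ) ^ (α : ℝ)) := by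
        refine ENNReal.ofReal_le_ofReal ?_
        rw [holderConst₂_eq, add_mul]
        nlinarith [norm_nonneg pol, holderConst₁_nonneg]

/-- **Hölder norm of the velocity**: `‖u_m (t)‖_{C^{0,α}} ≤ |a_m (t)| K₂ N^α`. [folklore] -/
theorem boundedHolderNorm_vel_le {α : ℝ≥0} (hα : α ≤ 1) (m : ℕ) (t : ℝ) :
    boundedHolderNorm α (vel m t) ≤
      |amp m t| * (holderConst₂ * (((m + 1 : ℕ) : ℝ)) ^ (α : ℝ)) := by
  have hX := eBoundedHolderNorm_profile_le hα (Nat.succ_pos m)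
  unfold boundedHolderNorm
  rw [vel, eBoundedHolderNorm_const_smul, ENNReal.toReal_mul, toReal_enorm, Real.norm_eq_abs]
  exact mul_le_mul_of_nonneg_left
    (ENNReal.toReal_le_of_le_ofReal
      (mul_nonneg holderConst₂_nonneg (Real.rpow_nonneg (Nat.cast_nonneg _) _)) hX)
    (abs_nonneg _)

/-- The `C⁰` (`α = 0`) norm of the profile: `‖P_N‖_∞ + [P_N]_0 ≤ 3 ‖z‖`. [folklore] -/
theorem eBoundedHolderNorm_zero_profile_le (N : ℕ) :
    eBoundedHolderNorm 0 (profile N) ≤ ENNReal.ofReal (3 * ‖pol‖) := by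
  have hH : HolderWith (2 * ‖pol‖₊) 0 (profile N) := by
    intro x y
    rw [NNReal.coe_zero, ENNReal.rpow_zero, mul_one]
    exact edist_le_coe.2 (dist_le_coe.1 (by
      push_cast [coe_nnnorm]
      exact dist_profile_le N x y))
  calc eBoundedHolderNorm 0 (profile N)
      ≤ ENNReal.ofReal ‖pol‖ + ((2 * ‖pol‖₊ : ℝ≥0) : ℝ≥0∞) :=
        add_le_add (eSupNorm_le_ofReal (norm_profile_le N)) hH.eHolderNorm_le
    _ = ENNReal.ofReal (3 * ‖pol‖) := by
        rw [← ENNReal.ofReal_coe_nnreal, ← ENNReal.ofReal_add (norm_nonneg _) (by positivity)]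
        congr 1
        push_cast [coe_nnnorm]
        ring

/-- **`C⁰` norm of the force**: `‖f_m (t)‖_{C⁰} ≤ 3 ‖z‖ b_m (t)`. [folklore] -/
theorem boundedHolderNorm_force_le (m : ℕ) (t : ℝ) :
    boundedHolderNorm 0 (force m t) ≤ 3 * ‖pol‖ * forceAmp m t := by
  have hX := eBoundedHolderNorm_zero_profile_le (m + 1)
  unfold boundedHolderNorm
  rw [force, eBoundedHolderNorm_const_smul, ENNReal.toReal_mul, toReal_enorm, Real.norm_eq_abs,
    abs_of_nonneg (forceAmp_nonneg m t), mul_comm]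
  exact mul_le_mul_of_nonneg_right
    (ENNReal.toReal_le_of_le_ofReal (by positivity) hX) (forceAmp_nonneg m t)

/-! ## The uniform bounds -/

/-- **Forces bounded in `L¹_t C⁰_x`**: `‖f_m‖_{L¹([0,1]; C⁰)} ≤ 3‖z‖/2` uniformly in `m`. [folklore] -/
theorem eLpHolderNorm_force_le (m : ℕ) :
    eLpHolderNorm 1 0 (force m) (Icc 0 1) ≤ ENNReal.ofReal (3 * ‖pol‖ / 2) := by
  have h := eLpNorm_Icc_le_of_le (n := 1) one_ne_zero
    (φ := fun t => boundedHolderNorm 0 (force m t)) (B := fun t => 3 * ‖pol‖ * forceAmp m t)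
    (fun t _ => by
      rw [Real.norm_eq_abs,
        abs_of_nonneg (show (0 : ℝ) ≤ boundedHolderNorm 0 (force m t) from ENNReal.toReal_nonneg)]
      exact boundedHolderNorm_force_le m t)
    (continuous_const.mul (contDiff_forceAmp m).continuous)
  simp only [Nat.cast_one, pow_one, div_one, ENNReal.rpow_one] at h
  refine h.trans (ENNReal.ofReal_le_ofReal ?_)
  unfold forceAmp
  rw [intervalIntegral.integral_const_mul, intervalIntegral.integral_const_mul]
  have h2 := integral_E_pow_le m two_ne_zero
  have hr := rate_pos m
  calc 3 * ‖pol‖ * (rate m * ∫ t in (0 : ℝ)..1, E m t ^ 2)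
      ≤ 3 * ‖pol‖ * (rate m * (1 / (2 * rate m))) := by
        gcongr
        simpa using h2
    _ = 3 * ‖pol‖ / 2 := by field_simp

/-- **Solutions bounded in `L³_t C^α_x`** for `α < 1/3`:
`‖u_m‖_{L³([0,1]; C^{0,α})} ≤ (K₂³ / 12π²)^{1/3}` uniformly in `m`
(`∫₀¹ (|a_m| K₂ N^α)³ ≤ K₂³ N^{3α} / (3 r_m) = K₂³ N^{3α - 1} / 12π²`). [folklore] -/
theorem eLpHolderNorm_vel_le {α : ℝ≥0} (hα : α < 1 / 3) (m : ℕ) :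
    eLpHolderNorm 3 α (vel m) (Icc 0 1) ≤
      ENNReal.ofReal (holderConst₂ ^ 3 / (12 * Real.pi ^ 2)) ^ (1 / 3 : ℝ) := by
  have hα1 : α ≤ 1 := hα.le.trans (by exact_mod_cast (show (1 : ℝ) / 3 ≤ 1 by norm_num))
  set N : ℕ := m + 1 with hNdef
  have hN : (1 : ℝ) ≤ N := by simp [hNdef]
  have hN0 : (0 : ℝ) < N := by positivity
  set K : ℝ := holderConst₂ * (N : ℝ) ^ (α : ℝ) with hK
  have hK0 : 0 ≤ K := mul_nonneg holderConst₂_nonneg (Real.rpow_nonneg hN0.le _)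
  have h := eLpNorm_Icc_le_of_le (n := 3) three_ne_zero
    (φ := fun t => boundedHolderNorm α (vel m t)) (B := fun t => K * E m t)
    (fun t ht => by
      rw [Real.norm_eq_abs,
        abs_of_nonneg (show (0 : ℝ) ≤ boundedHolderNorm α (vel m t) from ENNReal.toReal_nonneg)]
      refine (boundedHolderNorm_vel_le hα1 m t).trans ?_
      rw [mul_comm]
      exact mul_le_mul_of_nonneg_left (abs_amp_le_E m ht.1) hK0)
    (continuous_const.mul (continuous_E m))
  have h3 : ((3 : ℕ) : ℝ≥0∞) = 3 := by norm_cast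
  rw [h3] at h
  unfold eLpHolderNorm
  refine h.trans ?_
  push_cast
  refine ENNReal.rpow_le_rpow (ENNReal.ofReal_le_ofReal ?_) (by norm_num)
  simp_rw [mul_pow]
  rw [intervalIntegral.integral_const_mul]
  have hI := integral_E_pow_le m three_ne_zero
  have hr := rate_pos m
  have hNα : ((N : ℝ) ^ (α : ℝ)) ^ 3 ≤ N := by
    rw [← Real.rpow_natCast, ← Real.rpow_mul hN0.le]
    conv_rhs => rw [← Real.rpow_one (N : ℝ)]
    refine Real.rpow_le_rpow_of_exponent_le hN ?_
    have : (α : ℝ) < 1 / 3 := by exact_mod_cast hα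
    push_cast
    linarith
  calc K ^ 3 * ∫ t in (0 : ℝ)..1, E m t ^ 3 ≤ K ^ 3 * (1 / (3 * rate m)) := by
        gcongr
        simpa using hI
    _ = holderConst₂ ^ 3 * ((N : ℝ) ^ (α : ℝ)) ^ 3 / (12 * Real.pi ^ 2 * N) := by
        rw [hK, mul_pow]
        unfold rate
        rw [hNdef]
        push_cast
        field_simp
        ring
    _ ≤ holderConst₂ ^ 3 * N / (12 * Real.pi ^ 2 * N) := by
        gcongr
        exact pow_nonneg holderConst₂_nonneg 3
    _ = holderConst₂ ^ 3 / (12 * Real.pi ^ 2) := by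
        field_simp

end PulsedShear

open PulsedShear Literature.Analysis.FunctionSpaces in
/-- **Discharge of `bccds_onsager_critical` (turb.S13).** For every `α < 1/3` the pulsed Stokes
shear flows `u_m = a_m P_{m+1}` of this file (viscosities `ν_m = 1/(m+1)`, zero datum, zero
pressure, forces `f_m = r_m E_m² P_{m+1}`) are smooth classical solutions of forced Navier–Stokes
on `[0,1] × T³` with `sup_m ‖f_m‖_{L¹_t C⁰_x} ≤ 3√2/2`, `ν_m ∫₀¹ ‖∇u_m‖₂² ≥ 1/24` and
`sup_m ‖u_m‖_{L³_t C^{0,α}_x} < ∞`.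

**Caveat on what this proves.** The vendored `bccds_onsager_critical` asks for the force bound
only in `L¹_t C⁰_x`; in that class anomalous dissipation is a *linear* phenomenon (no convective
term is used above: `(u_m·∇)u_m ≡ 0`), as Bruè–Colombo–Crippa–De Lellis–Sorella themselves remark
for the forced heat equation (arXiv:2212.08413, §1, Remark 2). Their Theorem 1 (the main theorem,
cited in `AnomalousDissipation.lean` as Thm. 1.1) is a much stronger statement — forces bounded in
`L^{1+σ}_t C^σ_x` for some `σ > 0`, solutions also bounded in `L^∞_{t,x}`, mean-zero
divergence-free datum — whose proof (§§2–4, via Colombo–Crippa–Sorella 2022) is not formalised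
here. This theorem therefore discharges the named fact *as stated* and flags it as a degenerate
weakening of the source.
[cite: BCCDS2024, §1 Theorem 1 and Remark 2 (arXiv:2212.08413 numbering)] -/
theorem bccds_onsager_critical_holds : bccds_onsager_critical := by
  intro α hα
  refine ⟨nu, datum, force, vel, pres, isVanishingViscosity_nu, isSmooth_datum,
    fun m => isSmoothSpaceTimeOn_force m _, fun m => ⟨isClassicalNSSolutionOn_vel m, vel_zero m⟩,
    ⟨ENNReal.ofReal (3 * ‖pol‖ / 2), ENNReal.ofReal_lt_top, eLpHolderNorm_force_le⟩,
    hasAnomalousDissipation_vel,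
    ⟨ENNReal.ofReal (holderConst₂ ^ 3 / (12 * Real.pi ^ 2)) ^ (1 / 3 : ℝ),
      ENNReal.rpow_lt_top_of_nonneg (by norm_num) ENNReal.ofReal_ne_top,
      fun m => eLpHolderNorm_vel_le hα m⟩⟩

end Literature.Analysis.FluidPDE
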